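import Mathlib
import Summits.Schanuel.Schanuel.Theses.RelationCounting
import Summits.Schanuel.Schanuel.Theorems.MinimalCounterexampleInAcl.Negative.LoadBearingHypotheses

/-!
# Line `birth` — BC3 skeleton for the crux `Amplification` (stmt-Schanuel-16239)

Route `RelationCounting` (route-Schanuel-RelationCounting), crux (rank 9; the third hypothesis of the
route's deciding theorem `closes`) `Summit.Schanuel.Schanuel.Theses.RelationCounting.Amplification` —
WIDTH AMPLIFICATION: if Schanuel fails there are a level `k ≥ 1` and a strip height `b > 0` such that
for EVERY width `M ≥ k + 2` the counted points of `ℂ^M` at complexity `T` (box `|Re wᵢ| ≤ T`, strip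
`|Im wᵢ| ≤ b`, some `k + 1` coordinates `ℚ`-linearly independent, `s ≥ 2M − k` integer relations of
degree and height `≤ T` at `(w, e^w)` with `ℂ`-independent gradients, `M` of them a non-degenerate
Khovanskii system) number at least `⌈c·T^((M−k−1)k)⌉` for all large `T`.

THE LINE (`slab rows`; the route-repair construction of 2026-08-16: no `2πi`-padding, no period
shift).  A first failure `x ∈ ℂ^{k+1}` of Schanuel (`k + 1 ≥ 2` by Hermite–Lindemann, tree
`firstFailure_two_le`) carries a PRESENTATION: `k + 2` integer relations at `(x, eˣ)` with
`ℂ`-independent gradients, the first `k + 1` a non-degenerate Khovanskii system.  For a width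
`M = k + 1 + R` every integer SLAB MATRIX `K ∈ ℤ^{R × (k+1)}` (rows `K_r` with `|K_r · Im x| ≤ b`)
gives the AMPLIFIED POINT `w(K) = (x, K x) ∈ ℂ^M`; it is counted at complexity `T ≍ ‖K‖∞` (base
relations renamed, `R` linear rows `X_{k+1+r} − Σⱼ K_{rj} Xⱼ`, `R` binomial rows
`Y_{k+1+r}·∏_{K_{rj}<0} Yⱼ^{−K_{rj}} − ∏_{K_{rj}>0} Yⱼ^{K_{rj}}`; gradients block-triangular; the
`M × M` Khovanskii minor on the base Khovanskii rows and the linear rows is `det(base)·1`), distinct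
`K` give distinct `w(K)` because `x` is `ℚ`-linearly independent, and the slab matrices of sup-norm
`≤ N` number `≥ c·N^{R k}` (`k` free entries per row in `[−N, N]`, the last one solved for the slab).
One stub per ingredient, each stated over Mathlib (+ the set `counted`, which is the crux's own
set-builder with the width as a parameter):

* `stub_presentation` — THE ARITHMETIC INPUT: the route's support item `FirstFailurePresentation`
  (stmt-Schanuel-16240) BY NAME — a first failure admits `n + 1` integer relations with independent
  gradients, the first `n` a non-degenerate Khovanskii system (tree `firstFailure_khovanskii` with
  denominators cleared + one minimal-polynomial relation whose gradient leaves the Khovanskii span,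
  `dim Ω_{ℚ(x,eˣ)/ℚ} = trdeg = n − 1`).  Size M.
* `stub_rowsCounted` — THE ALGEBRA: for ANY `ℚ`-linearly independent seed `z ∈ ℂ^{k+1}` with such a
  presentation, any `b ≥ maxᵢ |Im zᵢ|` and any `R`, there is `C > 0` such that every slab matrix `K`
  of sup-norm `≤ N` gives a counted point `w(K) ∈ counted (k+1+R) k b T` as soon as
  `T ≥ C (N + 1)` (relation bookkeeping: degrees `≤ 1 + (k+1)N`, heights `≤ N`, vanishing, gradient
  independence, Khovanskii determinant).  Size L (MvPolynomial bookkeeping), unconditional.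
* `stub_slabCount` — THE COUNTING: for any `ℚ`-linearly independent `z ∈ ℂ^{k+1}` there is a strip
  height `b > 0`, `b ≥ maxᵢ |Im zᵢ|`, such that for every `R` the slab matrices of sup-norm `≤ C N`
  contain a finite family of size `≥ c N^{R k}` (all `N ≥ 1`) on which `K ↦ w(K)` is injective
  (lattice points in a slab + `ℚ`-independence of `z`).  Size M, unconditional, elementary.
* `amplification_of_pieces : stub₁-sig → stub₂-sig → stub₃-sig → ⟨Amplification unfolded⟩` — REAL proof: first
  failure from `¬ Schanuel` (tree `exists_firstFailure_of_not_schanuel`), rank `≥ 2`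
  (`firstFailure_two_le`), `n = k + 1`, `M = k + 1 + R`, `N = T / (2 C' C)`,
  `c' = c / (2 C' C)^{R k}`, `⌈c' T^{R k}⌉ ≤ #family = encard(image) ≤ encard(counted)`; and
  `Amplification_of : Amplification` applies it to the three stubs BY NAME.

No stub mentions the summit; no stub is the crux (stub 1 is unconditional first-failure algebra with
no counting, stubs 2–3 are unconditional statements about arbitrary `ℚ`-independent seeds — the crux
is their composition only through the first-failure EXISTENCE supplied by `¬ Schanuel`).
`sorry` occurs ONLY in the three `stub_*` theorems.

References: G. Binyamini, G. Hirata-Kohno, M. Kawashima, N. Salant, arXiv:2604.15189, Conj. 1 and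
§2.3 (relation counting); J. Pila, Ann. Inst. Fourier 60 (2010) 489–514, p. 493 (counting on a group
⇒ transcendence); S. Lang, *Introduction to transcendental numbers* (1966) pp. 30–31; J. Kirby,
Bull. LMS 42 (2010) Prop. 7.2 and J. Ax, Ann. of Math. 93 (1971) Thm. 3 (first failures are
non-degenerate Khovanskii points: tree `firstFailure_khovanskii`).
-/

-- `Summit.Schanuel.Schanuel.…`: the duplicated component is the mandated layout of this single-conjunct summit.
set_option linter.dupNamespace false

noncomputable section

namespace Summit.Schanuel.Schanuel.Cruxes.Amplification.Birth

open Summit.Schanuel.Schanuel.Theses.RelationCounting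
open Summit.Schanuel.Schanuel.Theorems.MinimalCounterexampleInAcl.Negative
open scoped BigOperators

/-! ## The counted set of the route (width as a parameter) -/

/-- `counted M k b T`: the set of COUNTED POINTS of `ℂ^M` at level `k`, strip height `b` and
complexity `T` — VERBATIM the set-builder of the route's three decls `CountingGapHigher`,
`CountingGapPair` (at `k = 1`) and `Amplification`, with the width `M` as a parameter: box/strip,
some `k + 1` coordinates `ℚ`-linearly independent, `s ≥ 2M − k` integer relations of total degree and
coefficients `≤ T` vanishing at `(w, e^w)` with `ℂ`-linearly independent gradients, `M` of them (chosen
by `e`) with non-vanishing Khovanskii determinant `det((∂_{Xⱼ} + Yⱼ∂_{Yⱼ}) P_{e i})(w, e^w)`.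
[cite: arXiv:2604.15189, Conj. 1 and §2.3] -/
def counted (M k : ℕ) (b T : ℝ) : Set (Fin M → ℂ) :=
  {w : Fin M → ℂ | (∀ i, |(w i).re| ≤ T ∧ |(w i).im| ≤ b) ∧ (∃ f : Fin (k + 1) ↪ Fin M, LinearIndependent ℚ (w ∘ f)) ∧ ∃ (s : ℕ) (P : Fin s → MvPolynomial (Fin M ⊕ Fin M) ℤ) (e : Fin M ↪ Fin s), 2 * M ≤ s + k ∧ (∀ j, ((P j).totalDegree : ℝ) ≤ T ∧ ∀ mo, |(((P j).coeff mo : ℤ) : ℝ)| ≤ T) ∧ (∀ j, MvPolynomial.aeval (Sum.elim w (Complex.exp ∘ w)) (P j) = 0) ∧ LinearIndependent ℂ (fun j => fun i : Fin M ⊕ Fin M => MvPolynomial.aeval (Sum.elim w (Complex.exp ∘ w)) (MvPolynomial.pderiv i (P j))) ∧ (Matrix.of fun i j : Fin M => MvPolynomial.aeval (Sum.elim w (Complex.exp ∘ w)) (MvPolynomial.pderiv (Sum.inl j) (P (e i)) + MvPolynomial.X (Sum.inr j) * MvPolynomial.pderiv (Sum.inr j) (P (e i)))).det ≠ 0}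

/-! ## The three registered OPEN stubs -/

/-- **Stub 1 (the arithmetic input = the route's support item `FirstFailurePresentation`,
stmt-Schanuel-16240, by name).**  A first failure `x ∈ ℂⁿ` of Schanuel (`ℚ`-linearly independent,
`trdeg ℚ(x, eˣ) < n`, Schanuel in all ranks `< n`) admits `n + 1` integer polynomial relations
vanishing at `(x, eˣ)` with `ℂ`-linearly independent gradients, the first `n` (indices `castSucc i`)
forming a non-degenerate Khovanskii system.  Plausible-true and provable now: the tree's
`firstFailure_khovanskii` (Kirby 2010 Prop. 7.2 / Ax 1971 Thm 3, pointwise) gives the `n` Khovanskii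
relations over `ℚ` (clear denominators); the `(n+1)`-st is a cleared minimal polynomial of one
coordinate over a transcendence basis chosen among the `2n` coordinates, and its gradient leaves the
span of the first `n` because the gradients of ALL relations at `(x, eˣ)` span a space of dimension
`2n − trdeg = n + 1` (`dim Ω_{ℚ(x,eˣ)/ℚ} = trdeg = n − 1`, tree `firstFailure_trdeg_eq`).  Why it might
fail: only formally — the Kähler-differential dimension count must be carried out for the
`ℤ`-integral model of the relation ideal.  [cite: Kirby2010EAEF, Prop. 7.2; Ax1971, Thm. 3] -/
theorem stub_presentation :
    Summit.Schanuel.Schanuel.Theses.RelationCounting.FirstFailurePresentation := by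
  sorry

/-- **Stub 2 (the algebra: amplified points are counted points).**  Let `z ∈ ℂ^{k+1}` be
`ℚ`-linearly independent with a presentation `P₀, …, P_{k+1}` (integer relations at `(z, e^z)`,
`ℂ`-independent gradients, `P ∘ castSucc` a non-degenerate Khovanskii system), `b ≥ maxᵢ |Im zᵢ|`
and `R ∈ ℕ`.  Then there is `C > 0` such that for every slab matrix `K ∈ ℤ^{R×(k+1)}`
(`|Σⱼ K_{rj} Im zⱼ| ≤ b` for all rows) of sup-norm `≤ N` (`N ≥ 0`) and every `T ≥ C (N + 1)` the
amplified point `w(K) = (z, K z) ∈ ℂ^{k+1+R}` lies in `counted (k+1+R) k b T`.  Witnesses: `f` = the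
seed block; `s = (k+2) + 2R` relations — the `P_j` renamed into the seed variables, the linear rows
`X_{k+1+r} − Σⱼ K_{rj} Xⱼ` (degree 1, height `≤ N`), the binomial rows
`Y_{k+1+r} ∏_{K_{rj}<0} Yⱼ^{−K_{rj}} − ∏_{K_{rj}>0} Yⱼ^{K_{rj}}` (degree `≤ 1 + (k+1)N`, coefficients
`±1`, vanishing by `e^{Σ K z} = ∏ (e^{zⱼ})^{K}`); gradients block lower-triangular (new `X`-columns:
identity on the linear rows; new `Y`-columns: the non-zero diagonal `∏(e^{zⱼ})^{−K⁻}` on the binomial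
rows); `e` = base Khovanskii rows then linear rows, Khovanskii matrix `[[J₀, 0], [−K, 1]]`,
`det = det J₀ ≠ 0`; box: `|Re (K_r·z)| ≤ N Σ|Re zⱼ| ≤ T`.  Unconditional, no transcendence input.
Why it might fail: only by a mis-set constant in this skeleton's reading of the clauses (e.g. the
`totalDegree`/`coeff` bounds of the renamed base relations need `T ≥ C`). [folklore] -/
theorem stub_rowsCounted :
    ∀ (k : ℕ) (z : Fin (k + 1) → ℂ), LinearIndependent ℚ z →
      ∀ P : Fin (k + 1 + 1) → MvPolynomial (Fin (k + 1) ⊕ Fin (k + 1)) ℤ,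
        (∀ j, MvPolynomial.aeval (Sum.elim z (Complex.exp ∘ z)) (P j) = 0) →
        LinearIndependent ℂ (fun j => fun i : Fin (k + 1) ⊕ Fin (k + 1) =>
          MvPolynomial.aeval (Sum.elim z (Complex.exp ∘ z)) (MvPolynomial.pderiv i (P j))) →
        (Matrix.of fun i j : Fin (k + 1) => MvPolynomial.aeval (Sum.elim z (Complex.exp ∘ z))
          (MvPolynomial.pderiv (Sum.inl j) (P (Fin.castSucc i)) + MvPolynomial.X (Sum.inr j) *
            MvPolynomial.pderiv (Sum.inr j) (P (Fin.castSucc i)))).det ≠ 0 →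
        ∀ (b : ℝ), (∀ i, |(z i).im| ≤ b) → ∀ (R : ℕ), ∃ C : ℝ, 0 < C ∧
          ∀ (K : Fin R → Fin (k + 1) → ℤ) (N : ℝ), 0 ≤ N → (∀ r j, |((K r j : ℤ) : ℝ)| ≤ N) →
            (∀ r, |∑ j, ((K r j : ℤ) : ℝ) * (z j).im| ≤ b) → ∀ (T : ℝ), C * (N + 1) ≤ T →
              Fin.append z (fun r => ∑ j, ((K r j : ℤ) : ℂ) * z j) ∈ counted (k + 1 + R) k b T := by
  sorry

/-- **Stub 3 (the counting: many slab matrices, injectively parametrising amplified points).**  For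
a `ℚ`-linearly independent `z ∈ ℂ^{k+1}` there is a strip height `b > 0` with `|Im zᵢ| ≤ b` such
that for every `R` there are `c, C > 0` with: for every real `N ≥ 1` a finite family `F` of integer
matrices `K ∈ ℤ^{R×(k+1)}` of sup-norm `≤ C N`, all slab (`|Σⱼ K_{rj} Im zⱼ| ≤ b`), of size
`#F ≥ c N^{R k}`, on which `K ↦ w(K) = (z, K z)` is injective.  Construction: `b = 1 + maxᵢ |Im zᵢ|`;
if `Im z = 0` take all `K` with entries in `[−N, N]`; otherwise fix `i₀` with `Im z_{i₀} ≠ 0`, choose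
the `k` entries `K_{rj}`, `j ≠ i₀`, freely in `[−N, N] ∩ ℤ` (`≥ N` choices each for `N ≥ 1`) and
`K_{r i₀}` = the nearest integer to `−Σ_{j≠i₀} K_{rj} Im zⱼ / Im z_{i₀}` (slab error
`≤ |Im z_{i₀}|/2 ≤ b`, `|K_{r i₀}| ≤ C N`); injectivity: `K z = K' z` forces `K = K'` row by row
because `z` is `ℚ`-linearly independent.  Unconditional and elementary.  Why it might fail: only by
a mis-set constant (the exponent `R k`, not `R (k+1)`, is what the slab leaves). [folklore] -/
theorem stub_slabCount :
    ∀ (k : ℕ) (z : Fin (k + 1) → ℂ), LinearIndependent ℚ z →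
      ∃ b : ℝ, 0 < b ∧ (∀ i, |(z i).im| ≤ b) ∧ ∀ (R : ℕ), ∃ c : ℝ, 0 < c ∧ ∃ C : ℝ, 0 < C ∧
        ∀ (N : ℝ), 1 ≤ N → ∃ F : Finset (Fin R → Fin (k + 1) → ℤ),
          c * N ^ (R * k) ≤ (F.card : ℝ) ∧
          (∀ K ∈ F, (∀ r j, |((K r j : ℤ) : ℝ)| ≤ C * N) ∧
            ∀ r, |∑ j, ((K r j : ℤ) : ℝ) * (z j).im| ≤ b) ∧
          Set.InjOn (fun K : Fin R → Fin (k + 1) → ℤ =>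
            Fin.append z (fun r => ∑ j, ((K r j : ℤ) : ℂ) * z j)) ↑F := by
  sorry

/-! ## The composition: the three stubs prove the crux BY NAME -/

/-- **Composition (sorry-free).**  From `¬ Schanuel`: a first failure `x ∈ ℂⁿ` (tree
`exists_firstFailure_of_not_schanuel`), `n ≥ 2` (tree `firstFailure_two_le`, Hermite–Lindemann), so
`n = k + 1` with `k ≥ 1`; stub 1 presents it; stub 3 gives the strip height `b` and, for each width
`M = k + 1 + R`, the families of slab matrices; stub 2 puts every amplified point of the family at
sup-norm `≤ C·N`, `N = T/(2C'C)`, into `counted M k b T` once `T ≥ max(2C'C, 2C')`; hence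
`⌈c/(2C'C)^{Rk} · T^{((M−k−1)k)}⌉ = ⌈c N^{Rk}⌉ ≤ #F = encard ↑F ≤ encard (counted M k b T)` by
injectivity.  The conclusion is the crux UNFOLDED through `counted` (definitionally equal to
`Amplification`; stated this way so that `Amplification_of` below is the file's only theorem whose
type is the crux constant). [folklore] -/
theorem amplification_of_pieces
    (h₁ : Summit.Schanuel.Schanuel.Theses.RelationCounting.FirstFailurePresentation)
    (h₂ : ∀ (k : ℕ) (z : Fin (k + 1) → ℂ), LinearIndependent ℚ z →
      ∀ P : Fin (k + 1 + 1) → MvPolynomial (Fin (k + 1) ⊕ Fin (k + 1)) ℤ,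
        (∀ j, MvPolynomial.aeval (Sum.elim z (Complex.exp ∘ z)) (P j) = 0) →
        LinearIndependent ℂ (fun j => fun i : Fin (k + 1) ⊕ Fin (k + 1) =>
          MvPolynomial.aeval (Sum.elim z (Complex.exp ∘ z)) (MvPolynomial.pderiv i (P j))) →
        (Matrix.of fun i j : Fin (k + 1) => MvPolynomial.aeval (Sum.elim z (Complex.exp ∘ z))
          (MvPolynomial.pderiv (Sum.inl j) (P (Fin.castSucc i)) + MvPolynomial.X (Sum.inr j) *
            MvPolynomial.pderiv (Sum.inr j) (P (Fin.castSucc i)))).det ≠ 0 →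
        ∀ (b : ℝ), (∀ i, |(z i).im| ≤ b) → ∀ (R : ℕ), ∃ C : ℝ, 0 < C ∧
          ∀ (K : Fin R → Fin (k + 1) → ℤ) (N : ℝ), 0 ≤ N → (∀ r j, |((K r j : ℤ) : ℝ)| ≤ N) →
            (∀ r, |∑ j, ((K r j : ℤ) : ℝ) * (z j).im| ≤ b) → ∀ (T : ℝ), C * (N + 1) ≤ T →
              Fin.append z (fun r => ∑ j, ((K r j : ℤ) : ℂ) * z j) ∈ counted (k + 1 + R) k b T)
    (h₃ : ∀ (k : ℕ) (z : Fin (k + 1) → ℂ), LinearIndependent ℚ z →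
      ∃ b : ℝ, 0 < b ∧ (∀ i, |(z i).im| ≤ b) ∧ ∀ (R : ℕ), ∃ c : ℝ, 0 < c ∧ ∃ C : ℝ, 0 < C ∧
        ∀ (N : ℝ), 1 ≤ N → ∃ F : Finset (Fin R → Fin (k + 1) → ℤ),
          c * N ^ (R * k) ≤ (F.card : ℝ) ∧
          (∀ K ∈ F, (∀ r j, |((K r j : ℤ) : ℝ)| ≤ C * N) ∧
            ∀ r, |∑ j, ((K r j : ℤ) : ℝ) * (z j).im| ≤ b) ∧
          Set.InjOn (fun K : Fin R → Fin (k + 1) → ℤ =>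
            Fin.append z (fun r => ∑ j, ((K r j : ℤ) : ℂ) * z j)) ↑F) :
    ¬ _root_.Schanuel → ∃ k : ℕ, 1 ≤ k ∧ ∃ b : ℝ, 0 < b ∧ ∀ M : ℕ, k + 2 ≤ M →
      ∃ c : ℝ, 0 < c ∧ ∀ᶠ T : ℝ in Filter.atTop,
        ((⌈c * T ^ (((M : ℝ) - k - 1) * k)⌉₊ : ℕ) : ℕ∞) ≤ (counted M k b T).encard := by
  intro hS
  -- a first failure, of rank `n = k + 1 ≥ 2`
  obtain ⟨n, x, hli, htr, hrank⟩ := exists_firstFailure_of_not_schanuel hS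
  have hn : 2 ≤ n := firstFailure_two_le hli htr
  obtain ⟨k, rfl⟩ : ∃ k, n = k + 1 := ⟨n - 1, by omega⟩
  have hk : 1 ≤ k := by omega
  -- its presentation (stub 1) and its strip height / slab families (stub 3)
  obtain ⟨P, hP0, hPli, hPdet⟩ := h₁ (k + 1) x hli htr (fun r hr y hy => hrank r hr y hy)
  obtain ⟨b, hb, hbx, hcount⟩ := h₃ k x hli
  refine ⟨k, hk, b, hb, fun M hM => ?_⟩
  -- width `M = k + 1 + R`
  obtain ⟨R, rfl⟩ : ∃ R, M = k + 1 + R := ⟨M - (k + 1), by omega⟩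
  obtain ⟨c, hc, C, hC, hF⟩ := hcount R
  obtain ⟨C', hC', hmem⟩ := h₂ k x hli P hP0 hPli hPdet b hbx R
  have hD : 0 < 2 * C' * C := by positivity
  refine ⟨c / (2 * C' * C) ^ (R * k), by positivity, ?_⟩
  filter_upwards [Filter.eventually_ge_atTop (max (2 * C' * C) (2 * C'))] with T hT
  have hTD : 2 * C' * C ≤ T := le_trans (le_max_left _ _) hT
  have hTC : 2 * C' ≤ T := le_trans (le_max_right _ _) hT
  have hT0 : 0 ≤ T := le_trans hD.le hTD
  have hN1 : 1 ≤ T / (2 * C' * C) := (one_le_div₀ hD).mpr hTD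
  have hN0 : 0 ≤ C * (T / (2 * C' * C)) := mul_nonneg hC.le (div_nonneg hT0 hD.le)
  obtain ⟨F, hcard, hKF, hinj⟩ := hF (T / (2 * C' * C)) hN1
  -- every amplified point of the family is counted at complexity `T`
  have hT' : C' * (C * (T / (2 * C' * C)) + 1) ≤ T := by
    have h1 : C' * (C * (T / (2 * C' * C)) + 1) = T / 2 + C' := by
      field_simp
    rw [h1]
    linarith
  have hmaps : Set.MapsTo (fun K : Fin R → Fin (k + 1) → ℤ =>
      Fin.append x (fun r => ∑ j, ((K r j : ℤ) : ℂ) * x j)) ↑F (counted (k + 1 + R) k b T) :=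
    fun K hK => hmem K (C * (T / (2 * C' * C))) hN0 (hKF K hK).1 (hKF K hK).2 T hT'
  -- the count
  have hexp : (((k + 1 + R : ℕ) : ℝ) - k - 1) * k = ((R * k : ℕ) : ℝ) := by
    push_cast
    ring
  have hceil : ⌈c / (2 * C' * C) ^ (R * k) * T ^ ((((k + 1 + R : ℕ) : ℝ) - k - 1) * k)⌉₊ ≤ F.card := by
    rw [hexp, Real.rpow_natCast]
    refine Nat.ceil_le.mpr ?_
    have h3 : c / (2 * C' * C) ^ (R * k) * T ^ (R * k) = c * (T / (2 * C' * C)) ^ (R * k) := by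
      rw [div_pow]
      ring
    rw [h3]
    exact hcard
  calc ((⌈c / (2 * C' * C) ^ (R * k) * T ^ ((((k + 1 + R : ℕ) : ℝ) - k - 1) * k)⌉₊ : ℕ) : ℕ∞)
      ≤ ((F.card : ℕ) : ℕ∞) := by exact_mod_cast hceil
    _ = (↑F : Set (Fin R → Fin (k + 1) → ℤ)).encard := (Set.encard_coe_eq_coe_finsetCard F).symm
    _ ≤ (counted (k + 1 + R) k b T).encard := Set.encard_le_encard_of_injOn hmaps hinj

/-- **THE SKELETON THEOREM.**  The crux `Summit.Schanuel.Schanuel.Theses.RelationCounting.Amplification`,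
concluded BY NAME from the three declared stubs (`counted M k b T` is the crux's set-builder verbatim,
so the composition's type is definitionally the crux). [folklore] -/
theorem Amplification_of : Amplification :=
  amplification_of_pieces stub_presentation stub_rowsCounted stub_slabCount

end Summit.Schanuel.Schanuel.Cruxes.Amplification.Birth

end
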